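import Mathlib
import Summits.Ventures.HodgeRepro2.Hypothesis
import Summits.Ventures.HodgeRepro2.BallActionU21
import Summits.Ventures.HodgeRepro2.Level
import Summits.Ventures.HodgeRepro2.LevelNeat
import Summits.Ventures.HodgeRepro2.DefiniteUnitaryBounded
import Summits.Ventures.HodgeRepro2.IntegralUnitaryDiscrete
import Summits.Ventures.HodgeRepro2.LevelDiscrete
import Summits.Ventures.HodgeRepro2.BallStabilizerBounded
import Summits.Ventures.HodgeRepro2.BallFreeAction

/-!
# The frame action as a `MulAction`, and the quotient `Γ\𝔹²`

The files `BallActionU21` (p395073), `InvariantFormsGroup` (p395164), `LevelDiscrete` and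
`BallFreeAction` treat the action of `Γ ⊆ U(H)` on the ball through a frame `Q`
(`ballAction (realEmbedding K τ₁ Q γ)`) lemma by lemma.  This file packages it as a Mathlib
`MulAction` of any subgroup `S ≤ U(H)` of `GL_3(K)` on the subtype `𝔹²` (`frameAction`), so that
Shimura's quotient `Γ\𝔹²` (J. Math. Soc. Japan 31 (1979), §4; DR15 §2) is Mathlib's orbit space
`MulAction.orbitRel.Quotient S ball₂` (`ballQuotient`), and restates the finiteness results in
Mathlib's vocabulary:

* `frameAction hQ S hS` — the action; `frameAction_smul_coe` — its formula;
* `finite_stabilizer_frameAction` — **`MulAction.stabilizer S z` is finite** for every `S ⊆ Γ_N`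
  and every `z ∈ 𝔹²` (any lattice `𝔪`, `H` definite off `τ₁`);
* `stabilizer_frameAction_shimuraLevel_eq_bot` — **for `N > 2` the stabilisers in `Γ_N` are
  trivial** (`Γ_N` acts freely; `isTorsionFreeSet_shimuraLevel`, LevelNeat p394366);
* `ballQuotient` / `ballQuotient_mk_eq_mk_iff` — the orbit space and its equality test.

The action is a `def`, not an instance (it depends on the frame `Q`); statements bind it with `letI`.
-/

open Matrix

namespace Summit.Ventures.HodgeRepro2.ShimuraData

section CMField

variable {K : Type*} [Field K] [NumberField K] [NumberField.IsCMField K]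

/-- The action of a subgroup `S ≤ U(H)` of `GL_3(K)` on the ball `𝔹²` through the frame `Q`:
`γ • z = ballAction (Q τ₁(γ) Q⁻¹) z`. -/
@[reducible] noncomputable def frameAction {τ₁ : K →+* ℂ} {H : Matrix (Fin 3) (Fin 3) K}
    {Q : Matrix (Fin 3) (Fin 3) ℂ} (hQ : IsFrame K τ₁ H Q) (S : Subgroup (GL (Fin 3) K))
    (hS : (S : Set (GL (Fin 3) K)) ⊆ unitaryGroup K H) : MulAction S ball₂ where
  smul γ z := ⟨ballAction (realEmbedding K τ₁ Q γ) z,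
    (hQ.isInU21_realEmbedding (hS γ.2)).ballAction_mem_ball₂ z.2⟩
  one_smul z := Subtype.ext (by
    show ballAction (realEmbedding K τ₁ Q ((1 : S) : GL (Fin 3) K)) z = z
    rw [Subgroup.coe_one, hQ.realEmbedding_one, ballAction_one])
  mul_smul γ γ' z := Subtype.ext (by
    show ballAction (realEmbedding K τ₁ Q ((γ * γ' : S) : GL (Fin 3) K)) z =
      ballAction (realEmbedding K τ₁ Q γ) (ballAction (realEmbedding K τ₁ Q γ') z)
    rw [Subgroup.coe_mul, hQ.realEmbedding_mul,
      IsInU21.ballAction_mul (hQ.isInU21_realEmbedding (hS γ'.2)) z.2])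

/-- The formula of the frame action. -/
theorem frameAction_smul_coe {τ₁ : K →+* ℂ} {H : Matrix (Fin 3) (Fin 3) K}
    {Q : Matrix (Fin 3) (Fin 3) ℂ} (hQ : IsFrame K τ₁ H Q) (S : Subgroup (GL (Fin 3) K))
    (hS : (S : Set (GL (Fin 3) K)) ⊆ unitaryGroup K H) (γ : S) (z : ball₂) :
    letI := frameAction hQ S hS
    ((γ • z : ball₂) : Fin 2 → ℂ) = ballAction (realEmbedding K τ₁ Q γ) z :=
  rfl

/-- A subgroup contained in `Γ_N` is contained in `U(H)`. -/
theorem subset_unitaryGroup_of_subset_shimuraLevel {H : Matrix (Fin 3) (Fin 3) K}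
    {𝔪 : Submodule ℤ (Fin 3 → K)} {N : ℕ} {S : Subgroup (GL (Fin 3) K)}
    (hS : (S : Set (GL (Fin 3) K)) ⊆ shimuraLevel K H 𝔪 N) :
    (S : Set (GL (Fin 3) K)) ⊆ unitaryGroup K H :=
  fun _ hγ => (hS hγ).1.1

/-- Membership in the stabiliser of the frame action, in terms of `ballAction`. -/
theorem mem_stabilizer_frameAction_iff {τ₁ : K →+* ℂ} {H : Matrix (Fin 3) (Fin 3) K}
    {Q : Matrix (Fin 3) (Fin 3) ℂ} (hQ : IsFrame K τ₁ H Q) (S : Subgroup (GL (Fin 3) K))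
    (hS : (S : Set (GL (Fin 3) K)) ⊆ unitaryGroup K H) (γ : S) (z : ball₂) :
    letI := frameAction hQ S hS
    γ ∈ MulAction.stabilizer S z ↔ ballAction (realEmbedding K τ₁ Q γ) z = z := by
  letI := frameAction hQ S hS
  rw [MulAction.mem_stabilizer_iff, Subtype.ext_iff]
  rfl

/-- **Finite stabilisers, in Mathlib's vocabulary.**  For a subgroup `S ⊆ Γ_N` and a point `z` of
the ball, `MulAction.stabilizer S z` is finite. -/
theorem finite_stabilizer_frameAction {τ₁ : K →+* ℂ} {H : Matrix (Fin 3) (Fin 3) K}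
    (hH : IsHermitianForm K H)
    (hdef : ∀ τ : K →+* ℂ, NumberField.InfinitePlace.mk τ ≠ NumberField.InfinitePlace.mk τ₁ →
      IsDefiniteAt K τ H)
    {Q : Matrix (Fin 3) (Fin 3) ℂ} (hQ : IsFrame K τ₁ H Q) {𝔪 : Submodule ℤ (Fin 3 → K)}
    (h𝔪 : IsLattice K 𝔪) {N : ℕ} {S : Subgroup (GL (Fin 3) K)}
    (hS : (S : Set (GL (Fin 3) K)) ⊆ shimuraLevel K H 𝔪 N) (z : ball₂) :
    letI := frameAction hQ S (subset_unitaryGroup_of_subset_shimuraLevel hS)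
    Finite (MulAction.stabilizer S z) := by
  letI := frameAction hQ S (subset_unitaryGroup_of_subset_shimuraLevel hS)
  have hfin := finite_stabilizer_of_subset_shimuraLevel hH hdef hQ h𝔪 hS z.2
  haveI := hfin.to_subtype
  refine Finite.of_injective
    (fun γ : MulAction.stabilizer S z =>
      (⟨((γ : S) : GL (Fin 3) K), (γ : S).2,
        (mem_stabilizer_frameAction_iff hQ S _ (γ : S) z).mp γ.2⟩ :
        {γ' : GL (Fin 3) K | γ' ∈ S ∧ ballAction (realEmbedding K τ₁ Q γ') z = z})) ?_
  intro γ γ' h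
  have := congrArg Subtype.val h
  exact Subtype.ext (Subtype.ext this)

/-- **`Γ_N` acts freely on the ball for `N > 2`**: every stabiliser of the frame action of
`shimuraLevelSubgroup K H 𝔪 N` is trivial. -/
theorem stabilizer_frameAction_shimuraLevel_eq_bot {τ₁ : K →+* ℂ} {H : Matrix (Fin 3) (Fin 3) K}
    (hH : IsHermitianForm K H)
    (hdef : ∀ τ : K →+* ℂ, NumberField.InfinitePlace.mk τ ≠ NumberField.InfinitePlace.mk τ₁ →
      IsDefiniteAt K τ H)
    {Q : Matrix (Fin 3) (Fin 3) ℂ} (hQ : IsFrame K τ₁ H Q) {𝔪 : Submodule ℤ (Fin 3 → K)}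
    (h𝔪 : IsLattice K 𝔪) {N : ℕ} (hN : 2 < N) (z : ball₂) :
    letI := frameAction hQ (shimuraLevelSubgroup K H 𝔪 N)
      (subset_unitaryGroup_of_subset_shimuraLevel (coe_shimuraLevelSubgroup K H 𝔪 N).subset)
    MulAction.stabilizer (shimuraLevelSubgroup K H 𝔪 N) z = ⊥ := by
  letI := frameAction hQ (shimuraLevelSubgroup K H 𝔪 N)
    (subset_unitaryGroup_of_subset_shimuraLevel (coe_shimuraLevelSubgroup K H 𝔪 N).subset)
  rw [Subgroup.eq_bot_iff_forall]
  intro γ hγ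
  rw [mem_stabilizer_frameAction_iff] at hγ
  have hγ' : (γ : GL (Fin 3) K) ∈ shimuraLevel K H 𝔪 N := by
    rw [← coe_shimuraLevelSubgroup]; exact γ.2
  exact Subtype.ext (eq_one_of_ballAction_eq_self_of_mem_shimuraLevel hH hdef hQ h𝔪 hN hγ' z.2 hγ)

/-- **The quotient `S\𝔹²`**: the orbit space of the frame action. -/
abbrev ballQuotient {τ₁ : K →+* ℂ} {H : Matrix (Fin 3) (Fin 3) K} {Q : Matrix (Fin 3) (Fin 3) ℂ}
    (hQ : IsFrame K τ₁ H Q) (S : Subgroup (GL (Fin 3) K))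
    (hS : (S : Set (GL (Fin 3) K)) ⊆ unitaryGroup K H) : Type :=
  @MulAction.orbitRel.Quotient S ball₂ _ (frameAction hQ S hS)

/-- The class of a point of the ball in `S\𝔹²`. -/
noncomputable def ballQuotient.mk {τ₁ : K →+* ℂ} {H : Matrix (Fin 3) (Fin 3) K}
    {Q : Matrix (Fin 3) (Fin 3) ℂ} (hQ : IsFrame K τ₁ H Q) (S : Subgroup (GL (Fin 3) K))
    (hS : (S : Set (GL (Fin 3) K)) ⊆ unitaryGroup K H) (z : ball₂) : ballQuotient hQ S hS :=
  @Quotient.mk'' _ (@MulAction.orbitRel S ball₂ _ (frameAction hQ S hS)) z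

/-- Two points of the ball have the same class in `S\𝔹²` iff they differ by an element of `S`. -/
theorem ballQuotient_mk_eq_mk_iff {τ₁ : K →+* ℂ} {H : Matrix (Fin 3) (Fin 3) K}
    {Q : Matrix (Fin 3) (Fin 3) ℂ} (hQ : IsFrame K τ₁ H Q) (S : Subgroup (GL (Fin 3) K))
    (hS : (S : Set (GL (Fin 3) K)) ⊆ unitaryGroup K H) (z z' : ball₂) :
    ballQuotient.mk hQ S hS z = ballQuotient.mk hQ S hS z' ↔
      ∃ γ : S, ballAction (realEmbedding K τ₁ Q γ) z' = z := by
  letI := frameAction hQ S hS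
  unfold ballQuotient.mk
  rw [Quotient.eq'', MulAction.orbitRel_apply, MulAction.mem_orbit_iff]
  constructor
  · rintro ⟨γ, hγ⟩
    exact ⟨γ, congrArg Subtype.val hγ⟩
  · rintro ⟨γ, hγ⟩
    exact ⟨γ, Subtype.ext hγ⟩

end CMField

end Summit.Ventures.HodgeRepro2.ShimuraData
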